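import Literature.Barriers.AtomisticToContinuum.DisorderedHarmonicChainDensityUpperMain
import Mathlib.MeasureTheory.Measure.HasOuterApproxClosed
import Mathlib.MeasureTheory.Measure.Regular
import Mathlib.MeasureTheory.Integral.Lebesgue.Map
import Mathlib.MeasureTheory.Function.Floor
import HarnessLib

/-!
# Ajanki–Huveneers 2011, Prop. 5.1: the upper bound (5.1) for all integrable test functions

Last file of the integration-by-parts route to the first half of Prop. 5.1 of O. Ajanki,
F. Huveneers, CMP **301** (2011) 841–883, arXiv:1003.1076:
"`𝔼(e^{w∑_{k=1}^n h(X^x_{k-1})B_k} u(X^x_n)) ≤ (K/(w√n)) ∫_𝕋 u(y) dy`, `u ∈ L¹(𝕋; ℝ₊)`, `wn ≥ κ`,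
`w²n ≤ 1`". `…DensityUpperMain.lean` proves it for continuous `u`
(`density_upper_continuous`); here the measure-theoretic extension, PROVED:

* `measure_le_smul_of_forall_lintegral_le`: a finite Borel measure on a (pseudo)metrizable
  space dominated on non-negative bounded continuous functions by `c · vol` is dominated as a
  measure (thickened indicators of closed sets, inner regularity);
* `periodic_density_bound`: transfer to the circle `ℝ/ℤ` — a weighted law of a real random
  variable dominated on continuous periodic test functions is dominated on all measurable periodic
  `u ≥ 0`, and charges no Lebesgue-null periodic set;
* `potentialTheory_upper`: **the first conjunct of `AjankiHuveneers2011_potentialTheory`,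
  verbatim** (for `u` merely integrable on `[0,1)` a measurable periodic modification is used, which
  the law of `X_n` does not see).

[cite: AjankiHuveneers2011, Prop. 5.1 eq. (5.1)]
-/

noncomputable section

open Real MeasureTheory Set Filter Function Topology
open scoped ENNReal NNReal BoundedContinuousFunction

namespace Literature.Barriers.AtomisticToContinuum.HeatConduction

/-! ### Domination of a measure from bounded continuous test functions -/

section Domination

/-- **A finite Borel measure dominated by `c · vol` on non-negative bounded continuous functions is
dominated by `c · vol`** (pseudo-metrizable space: closed sets by thickened indicators, then inner
regularity of finite measures). [folklore] -/
theorem measure_le_smul_of_forall_lintegral_le {X : Type*} [TopologicalSpace X]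
    [TopologicalSpace.PseudoMetrizableSpace X] [MeasurableSpace X] [BorelSpace X]
    (m vol : Measure X) [IsFiniteMeasure m] [IsFiniteMeasure vol] {c : ℝ≥0∞} (hc : c ≠ ⊤)
    (h : ∀ f : X →ᵇ ℝ≥0, ∫⁻ x, f x ∂m ≤ c * ∫⁻ x, f x ∂vol) : m ≤ c • vol := by
  -- closed sets
  have hclosed : ∀ F : Set X, IsClosed F → m F ≤ c * vol F := by
    intro F hF
    have h1 := HasOuterApproxClosed.tendsto_lintegral_apprSeq hF m
    have h2 := HasOuterApproxClosed.tendsto_lintegral_apprSeq hF vol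
    have h3 : Tendsto (fun n => c * ∫⁻ x, hF.apprSeq n x ∂vol) atTop (𝓝 (c * vol F)) :=
      ENNReal.Tendsto.const_mul h2 (Or.inr hc)
    exact le_of_tendsto_of_tendsto' h1 h3 fun n => h _
  -- measurable sets, by inner regularity with respect to closed sets
  refine Measure.le_iff.mpr fun A hA => ?_
  rw [Measure.smul_apply, smul_eq_mul, hA.measure_eq_iSup_isClosed_of_ne_top (measure_ne_top m A)]
  refine iSup_le fun K => iSup_le fun hKA => iSup_le fun hK => ?_
  exact (hclosed K hK).trans (mul_le_mul' le_rfl (measure_mono hKA))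

/-- **Transfer to the circle.** Let `Θ > 0` be an integrable weight and `X` a real random
variable on `(Ω, μ)`. If `∫ Θ φ(X) dμ ≤ c ∫_{[0,1)} φ` for all continuous `1`-periodic `φ ≥ 0`,
then `∫⁻ Θ u(X) dμ ≤ c ∫⁻_{[0,1)} u` for every measurable `1`-periodic `u ≥ 0`, and
`ℙ_μ(X mod 1 ∈ s) = 0` for every Lebesgue-null Borel `s ⊆ ℝ/ℤ`. [folklore] -/
theorem periodic_density_bound {Ω : Type*} [MeasurableSpace Ω] (μ : Measure Ω)
    {Θ : Ω → ℝ} (hΘm : Measurable Θ) (hΘ0 : ∀ ω, 0 < Θ ω) (hΘi : Integrable Θ μ)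
    {X : Ω → ℝ} (hX : Measurable X) {c : ℝ} (hc : 0 ≤ c)
    (hcont : ∀ φ : ℝ → ℝ, Continuous φ → Function.Periodic φ 1 → (∀ y, 0 ≤ φ y) →
      Integrable (fun ω => Θ ω * φ (X ω)) μ ∧ ∫ ω, Θ ω * φ (X ω) ∂μ ≤ c * ∫ y in Ico (0:ℝ) 1, φ y) :
    (∀ u : ℝ → ℝ≥0∞, Measurable u → Function.Periodic u 1 →
      ∫⁻ ω, ENNReal.ofReal (Θ ω) * u (X ω) ∂μ ≤ ENNReal.ofReal c * ∫⁻ y in Ico (0:ℝ) 1, u y) ∧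
    (∀ s : Set UnitAddCircle, MeasurableSet s → volume s = 0 →
      μ {ω | ((X ω : ℝ) : UnitAddCircle) ∈ s} = 0) := by
  set ν := μ.withDensity (fun ω => ENNReal.ofReal (Θ ω)) with hν
  haveI : IsFiniteMeasure ν := isFiniteMeasure_withDensity_ofReal hΘi.2
  set πX : Ω → UnitAddCircle := fun ω => ((X ω : ℝ) : UnitAddCircle) with hπX
  have hπXm : Measurable πX := AddCircle.measurable_mk'.comp hX
  set mT : Measure UnitAddCircle := ν.map πX with hmT
  haveI : IsFiniteMeasure mT := Measure.isFiniteMeasure_map ν πX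
  have hΘm' : Measurable fun ω => ENNReal.ofReal (Θ ω) := ENNReal.measurable_ofReal.comp hΘm
  -- the key computation
  have hkey : ∀ g : UnitAddCircle → ℝ≥0∞, Measurable g →
      ∫⁻ z, g z ∂mT = ∫⁻ ω, ENNReal.ofReal (Θ ω) * g (πX ω) ∂μ := by
    intro g hg
    rw [hmT, lintegral_map hg hπXm, hν]
    have := lintegral_withDensity_eq_lintegral_mul μ hΘm' (hg.comp hπXm)
    simpa [Function.comp] using this
  -- `∫⁻_{Ico 0 1} u = ∫⁻_T (lift u)` for periodic `u`
  have hcircle : ∀ u : ℝ → ℝ≥0∞, Measurable u → (hu : Function.Periodic u 1) →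
      ∫⁻ y in Ico (0:ℝ) 1, u y = ∫⁻ z, hu.lift z ∂volume := by
    intro u hum hu
    rw [← UnitAddCircle.lintegral_preimage 0 hu.lift]
    simp only [Function.Periodic.lift_coe, zero_add]
    exact setLIntegral_congr Ico_ae_eq_Ioc
  -- the domination from continuous test functions
  have hdom : mT ≤ ENNReal.ofReal c • (volume : Measure UnitAddCircle) := by
    refine measure_le_smul_of_forall_lintegral_le mT volume ENNReal.ofReal_ne_top fun f => ?_
    set φ : ℝ → ℝ := fun y => ((f ((y : ℝ) : UnitAddCircle) : ℝ≥0) : ℝ) with hφ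
    have hφc : Continuous φ := NNReal.continuous_coe.comp (f.continuous.comp (AddCircle.continuous_mk' 1))
    have hφper : Function.Periodic φ 1 := fun y => by
      simp only [hφ]; rw [AddCircle.coe_add_period]
    have hφ0 : ∀ y, 0 ≤ φ y := fun y => NNReal.coe_nonneg _
    obtain ⟨hint, hle⟩ := hcont φ hφc hφper hφ0
    have hfm : Measurable fun z : UnitAddCircle => (f z : ℝ≥0∞) := f.continuous.measurable.coe_nnreal_ennreal
    have hlhs : ∫⁻ z, (f z : ℝ≥0∞) ∂mT = ENNReal.ofReal (∫ ω, Θ ω * φ (X ω) ∂μ) := by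
      rw [hkey _ hfm, ofReal_integral_eq_lintegral_ofReal hint
        (ae_of_all _ fun ω => mul_nonneg (hΘ0 ω).le (hφ0 _))]
      refine lintegral_congr fun ω => ?_
      rw [ENNReal.ofReal_mul (hΘ0 ω).le]
      simp only [hφ, hπX, ENNReal.ofReal_coe_nnreal]
    have hrhs : ENNReal.ofReal (c * ∫ y in Ico (0:ℝ) 1, φ y) = ENNReal.ofReal c * ∫⁻ z, (f z : ℝ≥0∞) ∂volume := by
      rw [ENNReal.ofReal_mul hc]
      congr 1
      have hφi : IntegrableOn φ (Ico (0:ℝ) 1) := hφc.integrableOn_Icc.mono_set Ico_subset_Icc_self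
      rw [ofReal_integral_eq_lintegral_ofReal hφi (ae_of_all _ fun y => hφ0 y)]
      have hper' : Function.Periodic (fun y => ENNReal.ofReal (φ y)) 1 := fun y => by
        simp only [hφper y]
      have := hcircle (fun y => ENNReal.ofReal (φ y)) (ENNReal.measurable_ofReal.comp hφc.measurable) hper'
      rw [this]
      refine lintegral_congr fun z => ?_
      induction z using QuotientAddGroup.induction_on with
      | H y => rw [Function.Periodic.lift_coe]; simp only [hφ, ENNReal.ofReal_coe_nnreal]
    rw [hlhs, ← hrhs]
    exact ENNReal.ofReal_le_ofReal hle
  refine ⟨fun u hum hu => ?_, fun s hs hs0 => ?_⟩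
  · have hliftm : Measurable (hu.lift : UnitAddCircle → ℝ≥0∞) :=
      QuotientAddGroup.measurable_from_quotient.mpr hum
    calc ∫⁻ ω, ENNReal.ofReal (Θ ω) * u (X ω) ∂μ = ∫⁻ z, hu.lift z ∂mT := by
          rw [hkey _ hliftm]
          refine lintegral_congr fun ω => ?_
          simp only [hπX, Function.Periodic.lift_coe]
      _ ≤ ∫⁻ z, hu.lift z ∂(ENNReal.ofReal c • (volume : Measure UnitAddCircle)) := lintegral_mono' hdom le_rfl
      _ = ENNReal.ofReal c * ∫⁻ y in Ico (0:ℝ) 1, u y := by rw [lintegral_smul_measure, hcircle u hum hu, smul_eq_mul]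
  · have h1 : mT s = 0 := by
      have := hdom s
      rw [Measure.smul_apply, smul_eq_mul, hs0, mul_zero] at this
      exact le_antisymm this (zero_le)
    rw [hmT, Measure.map_apply hπXm hs, hν, withDensity_apply_eq_zero' hΘm'.aemeasurable] at h1
    have hset : {x | ENNReal.ofReal (Θ x) ≠ 0} ∩ πX ⁻¹' s = {ω | πX ω ∈ s} := by
      ext ω
      simp only [Set.mem_inter_iff, Set.mem_setOf_eq, Set.mem_preimage, ne_eq, ENNReal.ofReal_eq_zero, not_le]
      exact ⟨fun h => h.2, fun h => ⟨hΘ0 ω, h⟩⟩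
    rw [hset] at h1
    exact h1

end Domination

/-! ### A measurable periodic modification of an integrable periodic function -/

section Modification

/-- For `u ≥ 0` integrable on `[0,1)` there is a MEASURABLE `1`-periodic `ũ ≥ 0`,
integrable on `[0,1)`, with `u = ũ` a.e. on `[0,1)`, and a Lebesgue-null Borel set `N ⊆ [0,1)`
off which `u = ũ` on `[0,1)`. [folklore] -/
theorem exists_measurable_periodic_modification {u : ℝ → ℝ}
    (hu0 : ∀ y, 0 ≤ u y) (hint : IntegrableOn u (Set.Ico 0 1)) :
    ∃ v : ℝ → ℝ, Measurable v ∧ Function.Periodic v 1 ∧ (∀ y, 0 ≤ v y) ∧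
      (u =ᵐ[volume.restrict (Set.Ico 0 1)] v) ∧
      ∃ N : Set ℝ, MeasurableSet N ∧ volume N = 0 ∧ ∀ y ∈ Set.Ico (0:ℝ) 1, y ∉ N → u y = v y := by
  set f := hint.aestronglyMeasurable.mk u with hf
  have hfm : Measurable f := hint.aestronglyMeasurable.stronglyMeasurable_mk.measurable
  have hae : u =ᵐ[volume.restrict (Set.Ico 0 1)] f := hint.aestronglyMeasurable.ae_eq_mk
  set v : ℝ → ℝ := fun y => |f (Int.fract y)| with hv
  have hvm : Measurable v := (continuous_abs.measurable.comp hfm).comp measurable_fract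
  have hvper : Function.Periodic v 1 := fun y => by simp only [hv, Int.fract_add_one]
  have hv0 : ∀ y, 0 ≤ v y := fun y => abs_nonneg _
  -- off a null set of `[0,1)`, `u = f`, hence `u = v`
  have hnull : (volume.restrict (Set.Ico (0:ℝ) 1)) {y | u y ≠ f y} = 0 := ae_iff.mp hae
  obtain ⟨N₁, hN₁sub, hN₁m, hN₁0⟩ := exists_measurable_superset_of_null hnull
  rw [Measure.restrict_apply hN₁m] at hN₁0
  have hagree : ∀ y ∈ Set.Ico (0:ℝ) 1, y ∉ N₁ ∩ Set.Ico 0 1 → u y = v y := by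
    intro y hy hyN
    have huf : u y = f y := by
      by_contra hne
      exact hyN ⟨hN₁sub hne, hy⟩
    have hfr : Int.fract y = y := Int.fract_eq_self.mpr ⟨hy.1, hy.2⟩
    simp only [hv, hfr, ← huf, abs_of_nonneg (hu0 y)]
  refine ⟨v, hvm, hvper, hv0, ?_, N₁ ∩ Set.Ico 0 1, hN₁m.inter measurableSet_Ico, hN₁0, hagree⟩
  -- a.e. equality on `[0,1)`
  rw [Filter.EventuallyEq, ae_restrict_iff' measurableSet_Ico]
  have : ∀ᵐ y ∂(volume : Measure ℝ), y ∉ N₁ ∩ Set.Ico 0 1 := measure_eq_zero_iff_ae_notMem.mp hN₁0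
  filter_upwards [this] with y hy hyI
  exact hagree y hyI hy

end Modification

/-! ### The upper bound of Prop. 5.1 for all integrable `u` -/

section Upper

variable {τ : ℝ → ℝ} {bm bp : ℝ}

/-- The circle set of a Borel null set `N ⊆ [0,1)`: `{z | rep_{[0,1)}(z) ∈ N}` is Borel and null.
[folklore] -/
theorem circle_null_of_null {N : Set ℝ} (hNm : MeasurableSet N) (hN0 : volume N = 0) :
    MeasurableSet {z : UnitAddCircle | ((AddCircle.equivIco 1 0 z : Set.Ico (0:ℝ) (0 + 1)) : ℝ) ∈ N} ∧
      volume {z : UnitAddCircle | ((AddCircle.equivIco 1 0 z : Set.Ico (0:ℝ) (0 + 1)) : ℝ) ∈ N} = 0 := by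
  set s : Set UnitAddCircle := {z | ((AddCircle.equivIco 1 0 z : Set.Ico (0:ℝ) (0 + 1)) : ℝ) ∈ N} with hs
  have hsm : MeasurableSet s := by
    have : s = (fun z : UnitAddCircle => ((AddCircle.measurableEquivIco 1 0 z : Set.Ico (0:ℝ) (0 + 1)) : ℝ)) ⁻¹' N := rfl
    rw [this]
    exact (measurable_subtype_coe.comp (AddCircle.measurableEquivIco 1 0).measurable) hNm
  refine ⟨hsm, ?_⟩
  rw [AddCircle.add_projection_respects_measure 1 0 hsm, zero_add]
  -- the preimage inside `(0, 1]` is contained in `N ∪ {1}`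
  have hsub : (QuotientAddGroup.mk ⁻¹' s ∩ Set.Ioc (0:ℝ) 1) ⊆ N ∪ {1} := by
    intro y ⟨hy, hyI⟩
    simp only [Set.mem_preimage, hs, Set.mem_setOf_eq] at hy
    have hrep : ((AddCircle.equivIco 1 0 (QuotientAddGroup.mk y) : Set.Ico (0:ℝ) (0 + 1)) : ℝ) = Int.fract y := by
      have := AddCircle.coe_equivIco_mk_apply (p := (1:ℝ)) y
      rw [div_one, mul_one] at this
      exact this
    rw [hrep] at hy
    rcases hyI.2.lt_or_eq with hlt | heq
    · left
      have : Int.fract y = y := Int.fract_eq_self.mpr ⟨hyI.1.le, hlt⟩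
      rwa [this] at hy
    · right; exact heq
  refine measure_mono_null hsub ?_
  rw [measure_union_null_iff]
  exact ⟨hN0, measure_singleton _⟩

set_option maxHeartbeats 800000 in
/-- **Prop. 5.1, the upper bound (5.1)** — the first conjunct of
`AjankiHuveneers2011_potentialTheory`, verbatim: "Let `κ > 0`, and let `h ∈ C¹(𝕋)`. There exist
`K, w₀ > 0` such that, for every `w ∈ ]0,w₀]`, for every function `u ∈ L¹(𝕋; ℝ₊)`, for every
`x ∈ ℝ`, and for every `n ∈ ℕ`, one has `𝔼(e^{w∑_{k=1}^n h(X^x_{k-1})B_k} u(X^x_n)) ≤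
(K/(w√n)) ∫_𝕋 u(y) dy` (`wn ≥ κ`, `w²n ≤ 1`)" (with the finiteness of the expectation).
Proof: `density_upper_continuous` (integration by parts on the disorder) and
`periodic_density_bound`; this replaces the paper's parametrix (Lemmas 5.2–5.5).
[cite: AjankiHuveneers2011, Prop. 5.1 eq. (5.1)] -/
theorem potentialTheory_upper (τ : ℝ → ℝ) (bm bp : ℝ) (hτ : ReducedLawHyp τ bm bp)
    (ρB : Measure ℝ) [IsProbabilityMeasure ρB]
    (hρ : ρB = volume.withDensity fun s => ENNReal.ofReal (τ s))
    (κ : ℝ) (hκ : 0 < κ) (h : ℝ → ℝ) (hper : Function.Periodic h 1) (hh : ContDiff ℝ 1 h) :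
    ∃ K w₀ : ℝ, 0 < K ∧ 0 < w₀ ∧ ∀ w ∈ Set.Ioc 0 w₀,
      ∀ u : ℝ → ℝ, Function.Periodic u 1 → (∀ y, 0 ≤ u y) → IntegrableOn u (Set.Ico 0 1) →
        ∀ x : ℝ, ∀ n : ℕ, κ ≤ w * n → w ^ 2 * n ≤ 1 →
          Integrable (fun B : Fin n → ℝ =>
              Real.exp (w * ∑ k ∈ Finset.range n, h (ahPhase w x (finExt B) k) * finExt B k) *
                u (ahPhase w x (finExt B) n)) (Measure.pi fun _ : Fin n => ρB) ∧
          ∫ B, Real.exp (w * ∑ k ∈ Finset.range n, h (ahPhase w x (finExt B) k) * finExt B k) *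
              u (ahPhase w x (finExt B) n) ∂(Measure.pi fun _ : Fin n => ρB) ≤
            K / (w * Real.sqrt n) * ∫ y in Set.Ico 0 1, u y := by
  obtain ⟨K, w₀, hK, hw₀, hmain⟩ := density_upper_continuous hτ ρB hρ hκ hper hh
  refine ⟨K, w₀, hK, hw₀, fun w hw u huper hu0 huint x n hκn hwn => ?_⟩
  set μ := (Measure.pi fun _ : Fin n => ρB) with hμ
  set Θ : (Fin n → ℝ) → ℝ := fun B =>
    Real.exp (w * ∑ k ∈ Finset.range n, h (ahPhase w x (finExt B) k) * finExt B k) with hΘ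
  set X : (Fin n → ℝ) → ℝ := fun B => ahPhase w x (finExt B) n with hX
  have hΘm : Measurable Θ := by
    refine Real.measurable_exp.comp (measurable_const.mul (Finset.measurable_sum _ fun k _ => ?_))
    exact (hh.continuous.measurable.comp (measurable_ahPhase_pi w x k)).mul (measurable_finExt k)
  have hΘ0 : ∀ B, 0 < Θ B := fun B => Real.exp_pos _
  have hXm : Measurable X := measurable_ahPhase_pi w x n
  set c : ℝ := K / (w * Real.sqrt n) with hc
  have hw0 : 0 < w := hw.1
  have hc0 : 0 ≤ c := by rw [hc]; positivity
  -- `Θ` is integrable: the continuous case with `u ≡ 1`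
  have hΘi : Integrable Θ μ := by
    have := (hmain w hw (fun _ => 1) continuous_const (fun _ => rfl) (fun _ => zero_le_one) x n hκn hwn).1
    simpa [hΘ] using this
  -- the transfer lemma
  obtain ⟨hmeas, hnullT⟩ := periodic_density_bound μ hΘm hΘ0 hΘi hXm hc0
    (fun φ hφc hφper hφ0 => hmain w hw φ hφc hφper hφ0 x n hκn hwn)
  -- a measurable periodic modification of `u`
  obtain ⟨v, hvm, hvper, hv0, hae, N, hNm, hN0, hagree⟩ := exists_measurable_periodic_modification hu0 huint
  have hvint : IntegrableOn v (Set.Ico 0 1) := huint.congr hae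
  have hintv : ∫ y in Set.Ico (0:ℝ) 1, u y = ∫ y in Set.Ico (0:ℝ) 1, v y := integral_congr_ae hae
  -- `u(X) = v(X)` almost surely: the law of `X mod 1` does not charge the null circle set of `N`
  obtain ⟨hsm, hs0⟩ := circle_null_of_null hNm hN0
  have hbad0 := hnullT _ hsm hs0
  have haeX : (fun B => u (X B)) =ᵐ[μ] fun B => v (X B) := by
    refine (measure_eq_zero_iff_ae_notMem.mp hbad0).mono fun B hB => ?_
    show u (X B) = v (X B)
    by_contra hne
    apply hB
    simp only [Set.mem_setOf_eq]
    -- the representative of `X B` in `[0,1)` is `fract (X B)`, where `u ≠ v`, hence in `N`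
    have hrep : ((AddCircle.equivIco 1 0 ((X B : ℝ) : UnitAddCircle) : Set.Ico (0:ℝ) (0 + 1)) : ℝ) =
        Int.fract (X B) := by
      have := AddCircle.coe_equivIco_mk_apply (p := (1:ℝ)) (X B)
      rw [div_one, mul_one] at this
      exact this
    rw [hrep]
    have hfu : u (Int.fract (X B)) = u (X B) := by
      rw [← Int.self_sub_floor, show (X B - ⌊X B⌋ : ℝ) = X B - (⌊X B⌋ : ℤ) * (1:ℝ) by ring,
        huper.sub_int_mul_eq]
    have hfv : v (Int.fract (X B)) = v (X B) := by
      rw [← Int.self_sub_floor, show (X B - ⌊X B⌋ : ℝ) = X B - (⌊X B⌋ : ℤ) * (1:ℝ) by ring,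
        hvper.sub_int_mul_eq]
    by_contra hN
    exact hne (by rw [← hfu, ← hfv, hagree _ ⟨Int.fract_nonneg _, Int.fract_lt_one _⟩ hN])
  have haeΘ : (fun B => Θ B * u (X B)) =ᵐ[μ] fun B => Θ B * v (X B) :=
    haeX.mono fun B hB => by simp only [hB]
  -- the bound for `v`, in `ℝ≥0∞`
  have hvper' : Function.Periodic (fun y => ENNReal.ofReal (v y)) 1 := fun y => by simp only [hvper y]
  have hlin := hmeas (fun y => ENNReal.ofReal (v y)) (ENNReal.measurable_ofReal.comp hvm) hvper'
  have hrhs : ∫⁻ y in Set.Ico (0:ℝ) 1, ENNReal.ofReal (v y) = ENNReal.ofReal (∫ y in Set.Ico (0:ℝ) 1, v y) :=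
    (ofReal_integral_eq_lintegral_ofReal hvint (ae_of_all _ fun y => hv0 y)).symm
  rw [hrhs] at hlin
  have hprod : ∀ B, ENNReal.ofReal (Θ B) * ENNReal.ofReal (v (X B)) = ENNReal.ofReal (Θ B * v (X B)) :=
    fun B => (ENNReal.ofReal_mul (hΘ0 B).le).symm
  simp_rw [hprod] at hlin
  -- integrability of `Θ v(X)`
  have hΘvm : AEStronglyMeasurable (fun B => Θ B * v (X B)) μ := (hΘm.mul (hvm.comp hXm)).aestronglyMeasurable
  have hΘvi : Integrable (fun B => Θ B * v (X B)) μ := by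
    refine ⟨hΘvm, ?_⟩
    rw [hasFiniteIntegral_iff_ofReal (ae_of_all _ fun B => mul_nonneg (hΘ0 B).le (hv0 _))]
    exact lt_of_le_of_lt hlin (ENNReal.mul_lt_top ENNReal.ofReal_lt_top ENNReal.ofReal_lt_top)
  have hΘui : Integrable (fun B => Θ B * u (X B)) μ := hΘvi.congr haeΘ.symm
  refine ⟨hΘui, ?_⟩
  -- the bound
  have hle : ∫ B, Θ B * v (X B) ∂μ ≤ c * ∫ y in Set.Ico (0:ℝ) 1, v y := by
    have h2 : ENNReal.ofReal (∫ B, Θ B * v (X B) ∂μ) ≤ ENNReal.ofReal (c * ∫ y in Set.Ico (0:ℝ) 1, v y) := by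
      rw [ofReal_integral_eq_lintegral_ofReal hΘvi (ae_of_all _ fun B => mul_nonneg (hΘ0 B).le (hv0 _)),
        ENNReal.ofReal_mul hc0]
      exact hlin
    have h0 : 0 ≤ c * ∫ y in Set.Ico (0:ℝ) 1, v y :=
      mul_nonneg hc0 (setIntegral_nonneg measurableSet_Ico fun y _ => hv0 y)
    exact (ENNReal.ofReal_le_ofReal_iff h0).mp h2
  calc ∫ B, Θ B * u (X B) ∂μ = ∫ B, Θ B * v (X B) ∂μ := integral_congr_ae haeΘ
    _ ≤ c * ∫ y in Set.Ico (0:ℝ) 1, v y := hle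
    _ = K / (w * Real.sqrt n) * ∫ y in Set.Ico 0 1, u y := by rw [hc, hintv]

end Upper

end Literature.Barriers.AtomisticToContinuum.HeatConduction

end
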